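import Mathlib
import HarnessLib
import Summits.NavierStokesRegularity.NavierStokesRegularity.Theorems.PoloidalWindowDoorLrcModEntireShearedSecondOrder
import Summits.NavierStokesRegularity.NavierStokesRegularity.Theorems.PoloidalWindowDoorLrcModEntireQ4SonicSheetDataPackage

/-!
# Route `PoloidalWindowDoor`, item `LrcModEntire` (stmt-NavierStokesRegularity-20428), cell (Q4-sonic, straight, μ < 0) `stub_Q4sonicLineNeg`, case I —
# S5: THE CAUCHY DATA ON THE SPACE–TIME WEB SHEET IN Φ-CURRENCY — the difference field `U(·,·+Le) − U` (periodic branch) and the strain row `P, Q` (s-free branch)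

Cell ns-regularity-ideate, stub-worker seat ns-poloidal-K2-p2 g17 under the LEAD of item 20428 (ns-poloidal-K2-p3 g17, PICK 2026-08-29T20:42:04Z (P3) «S5-periodic
data … in Φ/pd currency like `cauchyData_g_of_package`»); `--supports stmt-NavierStokesRegularity-20428 --as helper`.  Companion of port-2 g8's
`…SheetCauchyData.cauchyData_g_of_package` (the data `g = ∂_mg = 0` of the `s`-free branch).

In ABSOLUTE time `t = −1+τ`, with the moving shear `Φ` of `…ShearedCoordinates` over the offset `d(t,z) := n₀(t+1,0,z)` (case I: webs parallel on the box), and the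
PERIODIC alternative of `…SonicSheetStrainWindow.sheet_strain_window` on a time interval `J = (τ₁, τ₂)` as a HYPOTHESIS —
`U(−1+τ, W_τ(s+L,z)) = U(−1+τ, W_τ(s,z))` for `τ ∈ J`, all `s`, `|z| < δ′` — the difference field `D(t,x) := U(t, x + L·e) − U(t, x)` (poloidal, divergence-free,
same slab law: LEAD's `…WeightSourceTranslate`) has, at every sheet point `(y,0)`, `y = (t,s,z)`, `t+1 ∈ J`, `|z| < δ′`:

* ★ `cauchyData_periodic_of_package` — **`D₂∘Φ = 0`, `∂_m(D₂∘Φ) = 0`, `⟪e, D⟫∘Φ = 0`, `⟪Je, D⟫∘Φ = 0`** (the four Cauchy data `ϑ = ∂_mϑ = P_D = Q_D = 0` of the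
  mixed-system template `…SheetSystemMixed.eq_zero_of_mixedSystem_template` for the DIFFERENCE unknowns, T2B-g17 §8(8b)/§9): the values because `W + L·e` is
  again a web point of the same sheet (parallel webs) where `U` takes the same value; the normal derivative because `∇ₕU₂` vanishes at both web points
  (conjunct 4 of the package block);
* ★ `cauchyData_sfree_of_strain` — the `s`-FREE alternative of `sheet_strain_window` (strain row `⟪DU(W)e,e⟫ = ⟪DU(W)e,Je⟫ = 0` on `(τ₁,τ₂)`) in the same
  currency: `(PST (uncurry U) e ∘ Φ)(y,0) = 0`, `(QST (uncurry U) e ∘ Φ)(y,0) = 0` — the `hP0`/`hQ0` of port-2's `…CaseISfreeBranch.caseI_sfree_false` on the tube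
  over `(τ₁,τ₂)`.

WHAT THIS IS NOT: not a claim about Navier–Stokes regularity and not a stub of the registry — data bookkeeping for the periodic sub-branch of case I of the research
slot `stub_Q4sonicLineNeg` (registry twist_split v13); no stub is closed here; items 20428 / 19708 / 27893 OPEN (bears_on LADDER-NS N0).
-/

noncomputable section

set_option linter.dupNamespace false
set_option linter.style.longLine false

namespace Summit.NavierStokesRegularity.NavierStokesRegularity.Theorems.PoloidalWindowDoorLrcModEntireSheetCauchyDataPeriodic

open Set Function Filter Topology Metric
open scoped RealInnerProductSpace InnerProductSpace ContDiff
open Literature.Analysis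
open Summit.NavierStokesRegularity.NavierStokesRegularity.Theorems.LocalSineTubeDoorProfileAlignedWindowRigidityAncient
open Summit.NavierStokesRegularity.NavierStokesRegularity.Theorems.PoloidalWindowDoorPoloidalWindowRigidityWindow
open Summit.NavierStokesRegularity.NavierStokesRegularity.Theorems.PoloidalWindowDoorLrcModEntireSheetSystemUniqueness
open Summit.NavierStokesRegularity.NavierStokesRegularity.Theorems.PoloidalWindowDoorLrcModEntireSheetFlattenTools
open Summit.NavierStokesRegularity.NavierStokesRegularity.Theorems.PoloidalWindowDoorLrcModEntireShearedCoordinates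
open Summit.NavierStokesRegularity.NavierStokesRegularity.Theorems.PoloidalWindowDoorLrcModEntireShearedKinematics
open Summit.NavierStokesRegularity.NavierStokesRegularity.Theorems.PoloidalWindowDoorLrcModEntireShearedSecondOrder

variable {C : ℝ} {U : ℝ → E3 → E3} {R μ : ℝ → ℝ → ℝ} {σ r ρ δ' : ℝ} {e : E3} {n₀ : ℝ × ℝ × ℝ → ℝ} {κt : ℝ → ℝ → ℝ}

/-- ★ **THE FOUR CAUCHY DATA OF THE DIFFERENCE FIELD ON THE WEB SHEET (periodic branch of case I).**  See the module docstring; `d(t,z) = n₀(t+1,0,z)`,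
`D(t,x) = U(t, x + L·e) − U(t, x)`; hypotheses: class `U` (for smoothness), the package block `hpack` on `δ′ < 1/2`, parallel webs on the box, an interval of
times `(τ₁, τ₂)` inside `|τ| < δ′` on which `L` is an `s`-period of `U(−1+τ)` along every web of `Σ_τ`. -/
theorem cauchyData_periodic_of_package
    (hrate : FluidPDE.HasTypeITimeDecay C U) (hcont : ContinuousOn (uncurry U) (Iio (0 : ℝ) ×ˢ univ))
    (hmild : ∀ s t : ℝ, s < t → t < 0 → ∀ x, U t x = UnboundedOperators.heatExtension (U s) (t - s) x - FluidPDE.oseenDuhamel 1 s U U t x)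
    (hdiv : ∀ t < 0, FluidPDE.VectorCalculus.IsDivFree (U t))
    (hδ'h : δ' < 1 / 2)
    (hpack : ∀ q : ℝ × ℝ × ℝ, |q.1| < δ' → |q.2.2| < δ' →
        n₀ q ∈ Ioo (-r) r ∧
        σ * U (-1 + q.1) (frameCLM e (q.2.1, n₀ q, q.2.2)) 2 = R q.1 q.2.2 ∧
        (∀ n ∈ Icc (-r) r, n ≠ n₀ q → σ * U (-1 + q.1) (frameCLM e (q.2.1, n, q.2.2)) 2 < R q.1 q.2.2) ∧
        (∀ w : E3, w 2 = 0 → fderiv ℝ (fun y => U (-1 + q.1) y 2) (frameCLM e (q.2.1, n₀ q, q.2.2)) w = 0) ∧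
        (∀ m : ℕ∞, ContDiffAt ℝ m n₀ q) ∧
        0 < κt q.1 q.2.2 ∧
        fderiv ℝ (fderiv ℝ (fun y => σ * U (-1 + q.1) y 2)) (frameCLM e (q.2.1, n₀ q, q.2.2)) e e +
            fderiv ℝ (fderiv ℝ (fun y => σ * U (-1 + q.1) y 2)) (frameCLM e (q.2.1, n₀ q, q.2.2)) (Jvec e) (Jvec e) =
          -κt q.1 q.2.2 ∧
        κt q.1 q.2.2 * (fderiv ℝ n₀ q ((0 : ℝ), (0 : ℝ), (1 : ℝ))) ^ 2 =
          (deriv (deriv (R q.1)) q.2.2 - μ (-1 + q.1) q.2.2 * κt q.1 q.2.2) * (1 + (fderiv ℝ n₀ q ((0 : ℝ), (1 : ℝ), (0 : ℝ))) ^ 2))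
    (hparI : ∀ τ s z : ℝ, |τ| < δ' → |z| < δ' → n₀ (τ, s, z) = n₀ (τ, (0 : ℝ), z))
    {L τ₁ τ₂ : ℝ} (hJ : ∀ τ ∈ Ioo τ₁ τ₂, |τ| < δ')
    (hper : ∀ τ ∈ Ioo τ₁ τ₂, ∀ s z : ℝ, |z| < δ' →
      U (-1 + τ) (frameCLM e (s + L, n₀ (τ, s + L, z), z)) = U (-1 + τ) (frameCLM e (s, n₀ (τ, s, z), z)))
    {y : Y3} (hyt : y.1 + 1 ∈ Ioo τ₁ τ₂) (hyz : |y.2.2| < δ') :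
    ((fun q : ℝ × E3 => (U q.1 (q.2 + L • e) - U q.1 q.2) 2) ∘ shearMap e (fun q : ℝ × ℝ => n₀ (q.1 + 1, (0 : ℝ), q.2))) (y, 0) = 0 ∧
      pd dN ((fun q : ℝ × E3 => (U q.1 (q.2 + L • e) - U q.1 q.2) 2) ∘ shearMap e (fun q : ℝ × ℝ => n₀ (q.1 + 1, (0 : ℝ), q.2))) (y, 0) = 0 ∧
      ((fun q : ℝ × E3 => ⟪e, U q.1 (q.2 + L • e) - U q.1 q.2⟫) ∘ shearMap e (fun q : ℝ × ℝ => n₀ (q.1 + 1, (0 : ℝ), q.2))) (y, 0) = 0 ∧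
      ((fun q : ℝ × E3 => ⟪Jvec e, U q.1 (q.2 + L • e) - U q.1 q.2⟫) ∘ shearMap e (fun q : ℝ × ℝ => n₀ (q.1 + 1, (0 : ℝ), q.2))) (y, 0) = 0 := by
  set d : ℝ × ℝ → ℝ := fun q => n₀ (q.1 + 1, (0 : ℝ), q.2) with hd_def
  set t : ℝ := y.1 with ht_def
  set s : ℝ := y.2.1 with hs_def
  set z : ℝ := y.2.2 with hz_def
  set τ : ℝ := t + 1 with hτ_def
  have hτ : |τ| < δ' := hJ _ hyt
  have hτt : -1 + τ = t := by rw [hτ_def]; ring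
  have ht0 : t < 0 := by
    have h := (abs_lt.1 hτ).2
    rw [hτ_def] at h; linarith [hδ'h]
  -- the web point and its translate
  set W : E3 := frameCLM e (s, n₀ (τ, s, z), z) with hW_def
  have hWL : W + L • e = frameCLM e (s + L, n₀ (τ, s + L, z), z) := by
    rw [hW_def, frameCLM_apply, frameCLM_apply, hparI τ s z hτ hyz, hparI τ (s + L) z hτ hyz]
    simp only [add_smul]; abel
  have hΦ : shearMap e d (y, 0) = (t, W) := by
    rw [hW_def, frameCLM_apply, hparI τ s z hτ hyz]
    simp [shearMap, shearPt, hd_def, ht_def, hs_def, hz_def, hτ_def]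
  -- the difference vanishes at the web point
  have hD0 : U t (W + L • e) - U t W = 0 := by
    rw [hWL, hW_def, ← hτt]
    exact sub_eq_zero.2 (hper τ hyt s z hyz)
  -- horizontal criticality at both web points
  obtain ⟨-, -, -, hhor, -, -, -, -⟩ := hpack (τ, s, z) hτ hyz
  obtain ⟨-, -, -, hhorL, -, -, -, -⟩ := hpack (τ, s + L, z) hτ hyz
  obtain ⟨-, -, -, -, hnC, -, -, -⟩ := hpack (τ, (0 : ℝ), z) hτ hyz
  simp only at hhor hhorL hnC
  rw [hτt] at hhor hhorL
  rw [← hW_def] at hhor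
  rw [← hWL] at hhorL
  -- regularity
  have hA := isTypeIAncientMild_of_class hrate hcont hmild hdiv
  have hslab : ContDiffOn ℝ ∞ (uncurry U) (Iio (0 : ℝ) ×ˢ univ) := hA.contDiffOn
  have hopen : IsOpen (Iio (0 : ℝ) ×ˢ (univ : Set E3)) := isOpen_Iio.prod isOpen_univ
  have hUdiff : ∀ x : E3, DifferentiableAt ℝ (uncurry U) (t, x) := fun x =>
    (hslab.contDiffAt (hopen.mem_nhds (show ((t, x) : ℝ × E3) ∈ Iio (0 : ℝ) ×ˢ univ from ⟨ht0, mem_univ _⟩))).differentiableAt (by simp)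
  set F : ℝ × E3 → ℝ := fun q => (U q.1 (q.2 + L • e) - U q.1 q.2) 2 with hF_def
  have hshift : DifferentiableAt ℝ (fun q : ℝ × E3 => ((q.1, q.2 + L • e) : ℝ × E3)) (t, W) :=
    differentiableAt_fst.prodMk (differentiableAt_snd.add (differentiableAt_const _))
  have hFd : DifferentiableAt ℝ F (t, W) := by
    have h1 : DifferentiableAt ℝ (fun q : ℝ × E3 => uncurry U (q.1, q.2 + L • e)) (t, W) := by
      have h := DifferentiableAt.comp (t, W) (hUdiff (W + L • e)) hshift
      exact h
    have h2 : DifferentiableAt ℝ (fun q : ℝ × E3 => uncurry U (q.1, q.2 + L • e) - uncurry U q) (t, W) := h1.sub (hUdiff W)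
    have h3 : DifferentiableAt ℝ (fun q : ℝ × E3 => (uncurry U (q.1, q.2 + L • e) - uncurry U q) 2) (t, W) :=
      (EuclideanSpace.proj (𝕜 := ℝ) (2 : Fin 3)).differentiableAt.comp (t, W) h2
    exact h3
  have hdp : DifferentiableAt ℝ d (((y, (0 : ℝ)) : Y3 × ℝ).1.1, ((y, (0 : ℝ)) : Y3 × ℝ).1.2.2) := by
    show DifferentiableAt ℝ d (t, z)
    have hline : ContDiff ℝ ∞ (fun q : ℝ × ℝ => ((q.1 + 1, (0 : ℝ), q.2) : ℝ × ℝ × ℝ)) :=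
      (contDiff_fst.add contDiff_const).prodMk (contDiff_const.prodMk contDiff_snd)
    have h1 : ContDiffAt ℝ ∞ n₀ ((fun q : ℝ × ℝ => ((q.1 + 1, (0 : ℝ), q.2) : ℝ × ℝ × ℝ)) (t, z)) := by
      simpa [hτ_def] using hnC ⊤
    exact (h1.comp (t, z) hline.contDiffAt).differentiableAt (by simp)
  -- the slice of `F` at time `t` and its derivative along `Je` at `W`
  have hUtd : Differentiable ℝ (U t) := (hA.contDiff_slice ht0).differentiable (by simp)
  have hθd : Differentiable ℝ (fun x : E3 => U t x 2) := fun x => (EuclideanSpace.proj (𝕜 := ℝ) (2 : Fin 3)).differentiableAt.comp x (hUtd x)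
  have hslice : fderiv ℝ F (t, W) ((0 : ℝ), Jvec e) = 0 := by
    rw [← fderiv_slice_eq' hFd (Jvec e)]
    have hfun : (fun x : E3 => F (t, x)) = fun x => U t (x + L • e) 2 - U t x 2 := by
      funext x; simp [hF_def]
    have hθWL : HasFDerivAt (fun x : E3 => U t (x + L • e) 2) (fderiv ℝ (fun x' : E3 => U t x' 2) (W + L • e)) W := by
      have h := ((hθd (W + L • e)).hasFDerivAt).comp W ((hasFDerivAt_id W).add_const (L • e))
      simpa [Function.comp_def] using h
    have hdiffF : HasFDerivAt (fun x : E3 => F (t, x))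
        (fderiv ℝ (fun x' : E3 => U t x' 2) (W + L • e) - fderiv ℝ (fun x' : E3 => U t x' 2) W) W := by
      rw [hfun]
      exact hθWL.sub (hθd W).hasFDerivAt
    rw [hdiffF.fderiv]
    simp only [FunLike.coe_sub, Pi.sub_apply]
    rw [hhorL (Jvec e) (by simp [Jvec]), hhor (Jvec e) (by simp [Jvec]), sub_zero]
  refine ⟨?_, ?_, ?_, ?_⟩
  · show F (shearMap e d (y, 0)) = 0
    rw [hΦ, hF_def]; simp only
    rw [hD0]; rfl
  · have hG : DifferentiableAt ℝ F (shearMap e d (y, 0)) := by rw [hΦ]; exact hFd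
    rw [pd_dN_comp_shearMap e d hG hdp, hΦ]
    exact hslice
  · show ⟪e, U (shearMap e d (y, 0)).1 ((shearMap e d (y, 0)).2 + L • e) - U (shearMap e d (y, 0)).1 (shearMap e d (y, 0)).2⟫ = 0
    rw [hΦ]; simp only
    rw [hD0, inner_zero_right]
  · show ⟪Jvec e, U (shearMap e d (y, 0)).1 ((shearMap e d (y, 0)).2 + L • e) - U (shearMap e d (y, 0)).1 (shearMap e d (y, 0)).2⟫ = 0
    rw [hΦ]; simp only
    rw [hD0, inner_zero_right]

/-- ★ **THE s-FREE DATA IN Φ-CURRENCY (branch 1 of `…SonicSheetStrainWindow.sheet_strain_window` ⇒ the `hP0`/`hQ0` of port-2's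
`…CaseISfreeBranch.caseI_sfree_false`).**  If on the time interval `(τ₁, τ₂)` (inside `|τ| < δ′`) the web-frame strain row vanishes at every web point —
`⟪DU(−1+τ)(W)e, e⟫ = ⟪DU(−1+τ)(W)e, Je⟫ = 0`, `W = frameCLM e (s, n₀(τ,s,z), z)`, `|z| < δ′` — then for every `y = (t,s,z)` with `t+1 ∈ (τ₁,τ₂)`, `|z| < δ′`:
`(PST (uncurry U) e ∘ Φ)(y,0) = 0` and `(QST (uncurry U) e ∘ Φ)(y,0) = 0`, `Φ = shearMap e d`, `d(t,z) = n₀(t+1,0,z)` (parallel webs on the box). -/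
theorem cauchyData_sfree_of_strain
    (hrate : FluidPDE.HasTypeITimeDecay C U) (hcont : ContinuousOn (uncurry U) (Iio (0 : ℝ) ×ˢ univ))
    (hmild : ∀ s t : ℝ, s < t → t < 0 → ∀ x, U t x = UnboundedOperators.heatExtension (U s) (t - s) x - FluidPDE.oseenDuhamel 1 s U U t x)
    (hdiv : ∀ t < 0, FluidPDE.VectorCalculus.IsDivFree (U t))
    (hδ'h : δ' < 1 / 2)
    (hparI : ∀ τ s z : ℝ, |τ| < δ' → |z| < δ' → n₀ (τ, s, z) = n₀ (τ, (0 : ℝ), z))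
    {τ₁ τ₂ : ℝ} (hJ : ∀ τ ∈ Ioo τ₁ τ₂, |τ| < δ')
    (hfree : ∀ τ ∈ Ioo τ₁ τ₂, ∀ s z : ℝ, |z| < δ' →
      ⟪fderiv ℝ (U (-1 + τ)) (frameCLM e (s, n₀ (τ, s, z), z)) e, e⟫ = 0 ∧
        ⟪fderiv ℝ (U (-1 + τ)) (frameCLM e (s, n₀ (τ, s, z), z)) e, Jvec e⟫ = 0)
    {y : Y3} (hyt : y.1 + 1 ∈ Ioo τ₁ τ₂) (hyz : |y.2.2| < δ') :
    (PST (uncurry U) e ∘ shearMap e (fun q : ℝ × ℝ => n₀ (q.1 + 1, (0 : ℝ), q.2))) (y, 0) = 0 ∧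
      (QST (uncurry U) e ∘ shearMap e (fun q : ℝ × ℝ => n₀ (q.1 + 1, (0 : ℝ), q.2))) (y, 0) = 0 := by
  set d : ℝ × ℝ → ℝ := fun q => n₀ (q.1 + 1, (0 : ℝ), q.2) with hd_def
  set t : ℝ := y.1 with ht_def
  set s : ℝ := y.2.1 with hs_def
  set z : ℝ := y.2.2 with hz_def
  set τ : ℝ := t + 1 with hτ_def
  have hτ : |τ| < δ' := hJ _ hyt
  have hτt : -1 + τ = t := by rw [hτ_def]; ring
  have ht0 : t < 0 := by
    have h := (abs_lt.1 hτ).2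
    rw [hτ_def] at h; linarith [hδ'h]
  set W : E3 := frameCLM e (s, n₀ (τ, s, z), z) with hW_def
  have hΦ : shearMap e d (y, 0) = (t, W) := by
    rw [hW_def, frameCLM_apply, hparI τ s z hτ hyz]
    simp [shearMap, shearPt, hd_def, ht_def, hs_def, hz_def, hτ_def]
  have hA := isTypeIAncientMild_of_class hrate hcont hmild hdiv
  have hslab : ContDiffOn ℝ ∞ (uncurry U) (Iio (0 : ℝ) ×ˢ univ) := hA.contDiffOn
  have hopen : IsOpen (Iio (0 : ℝ) ×ˢ (univ : Set E3)) := isOpen_Iio.prod isOpen_univ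
  have hUdiff : DifferentiableAt ℝ (uncurry U) (t, W) :=
    (hslab.contDiffAt (hopen.mem_nhds (show ((t, W) : ℝ × E3) ∈ Iio (0 : ℝ) ×ˢ univ from ⟨ht0, mem_univ _⟩))).differentiableAt (by simp)
  have hsl : fderiv ℝ (uncurry U) (t, W) ((0 : ℝ), e) = fderiv ℝ (U t) W e := by
    rw [← fderiv_slice_eq' hUdiff e]; rfl
  obtain ⟨h1, h2⟩ := hfree τ hyt s z hyz
  rw [hτt, ← hW_def] at h1 h2
  refine ⟨?_, ?_⟩
  · show PST (uncurry U) e (shearMap e d (y, 0)) = 0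
    rw [hΦ, PST, hsl, real_inner_comm]
    exact h1
  · show QST (uncurry U) e (shearMap e d (y, 0)) = 0
    rw [hΦ, QST, hsl, real_inner_comm]
    exact h2

end Summit.NavierStokesRegularity.NavierStokesRegularity.Theorems.PoloidalWindowDoorLrcModEntireSheetCauchyDataPeriodic

end
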